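import Literature.Computability.Cryptography.HILLExtract
import HarnessLib

/-!
# Extraction of flattened conditional entropy, smooth form (HILL Cor. 4.5.3)

`HILLExtract.extract_cond_test` pays the flattening failure `ε = e^{−2tη²}` inside the square root next to
`2^m` (the crude fibre bound `M_c = max fibre`). The form actually needed for HILL's Construction 7.0.4, where
`m` is of order `t`, is the *smooth* one: restrict the coin tuples to the LIGHT ones (all but an `ε`
fraction, `card_condHeavy_tuple_le_exp`), apply the generalized Leftover Hash Lemma on that base set (every
conditional fibre of a light point is below `2^{−kmin}` of its slice in the full space, so
`Σ_c M_c ≤ 2^{−kmin}|W|`), and pay `2ε` additively for the two restrictions: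
`|E F(real) − E F(uniform)| ≤ 2ε + ½ √(2^m · 2^{−kmin} · |W|/|W_light|)` (`extract_cond_test_smooth`).
[Håstad–Impagliazzo–Levin–Luby 1999, Cor. 4.5.3 with Prop. 4.4.1; Dodis et al. 2008 Lemma 2.4]
No new named facts.
-/

namespace Literature.Computability.Cryptography

open Finset Real Complexity AffineStr

namespace HILL

namespace Extract

variable {Ω V : Type*} [Fintype Ω] [Nonempty Ω] [DecidableEq Ω] [DecidableEq V] {c t : ℕ}

/-- The heavy coin tuples (conditional fibre at least `2^{−kmin}` of the slice). [folklore] -/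
noncomputable def heavySet (x : Ω → List.Vector Bool c) (y : Ω → V) (kmin : ℝ) : Finset (Fin t → Ω) :=
  Finset.univ.filter fun w : Fin t → Ω =>
    (2 : ℝ) ^ (-kmin) * ((fiber Finset.univ (fun v : Fin t → Ω => fun i => y (v i)) (fun i => y (w i))).card : ℝ) ≤
      ((fiber Finset.univ (fun v : Fin t → Ω => fun i => (x (v i), y (v i))) (fun i => (x (w i), y (w i)))).card : ℝ)

/-- The light coin tuples. [folklore] -/
noncomputable def lightSet (x : Ω → List.Vector Bool c) (y : Ω → V) (kmin : ℝ) : Finset (Fin t → Ω) :=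
  Finset.univ.filter fun w : Fin t → Ω =>
    ¬ ((2 : ℝ) ^ (-kmin) * ((fiber Finset.univ (fun v : Fin t → Ω => fun i => y (v i)) (fun i => y (w i))).card : ℝ) ≤
      ((fiber Finset.univ (fun v : Fin t → Ω => fun i => (x (v i), y (v i))) (fun i => (x (w i), y (w i)))).card : ℝ))

omit [Nonempty Ω] [DecidableEq Ω] in
/-- `|heavy| + |light| = |W|`. [folklore] -/
theorem card_heavy_add_light (x : Ω → List.Vector Bool c) (y : Ω → V) (kmin : ℝ) :
    (heavySet (t := t) x y kmin).card + (lightSet (t := t) x y kmin).card = Fintype.card (Fin t → Ω) := by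
  rw [heavySet, lightSet, Finset.card_filter_add_card_filter_not, Finset.card_univ]

omit [Nonempty Ω] [DecidableEq Ω] in
/-- **Fibres of light points are small**: for `w` light, `#{w' light : z w' = z w ∧ xvec w' = xvec w} ≤ 2^{−kmin}·#slice(z w)`. [folklore] -/
theorem card_light_fibre_le (x : Ω → List.Vector Bool c) (y : Ω → V) (kmin : ℝ) (cv : Fin t → V) (a : List.Vector Bool (t * c)) :
    ((((lightSet (t := t) x y kmin).filter fun w => ztup y w = cv ∧ xvec x w = a).card : ℕ) : ℝ) ≤
      (2 : ℝ) ^ (-kmin) * ((Finset.univ.filter fun w : Fin t → Ω => ztup y w = cv).card : ℝ) := by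
  classical
  by_cases hne : ((lightSet (t := t) x y kmin).filter fun w => ztup y w = cv ∧ xvec x w = a).Nonempty
  · obtain ⟨ws, hws⟩ := hne
    rw [Finset.mem_filter] at hws
    obtain ⟨hlight, hzs, hxs⟩ := hws
    rw [lightSet, Finset.mem_filter] at hlight
    have hlt := lt_of_not_ge hlight.2
    -- the two fibres through `ws`
    have hyfib : fiber Finset.univ (fun v : Fin t → Ω => fun i => y (v i)) (fun i => y (ws i)) = Finset.univ.filter fun w : Fin t → Ω => ztup y w = cv := by
      ext w; simp only [fiber, Finset.mem_filter, Finset.mem_univ, true_and] at hzs ⊢; rw [← hzs]; rfl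
    have hsub : ((lightSet (t := t) x y kmin).filter fun w => ztup y w = cv ∧ xvec x w = a) ⊆
        fiber Finset.univ (fun v : Fin t → Ω => fun i => (x (v i), y (v i))) (fun i => (x (ws i), y (ws i))) := by
      intro w hw
      rw [Finset.mem_filter] at hw
      obtain ⟨-, hzw, hxw⟩ := hw
      simp only [fiber, Finset.mem_filter, Finset.mem_univ, true_and]
      exact xvec_ztup_inj x y (hxw.trans hxs.symm) (hzw.trans hzs.symm)
    have h1 : ((((lightSet (t := t) x y kmin).filter fun w => ztup y w = cv ∧ xvec x w = a).card : ℕ) : ℝ) ≤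
        ((fiber Finset.univ (fun v : Fin t → Ω => fun i => (x (v i), y (v i))) (fun i => (x (ws i), y (ws i)))).card : ℝ) := by
      exact_mod_cast Finset.card_le_card hsub
    rw [hyfib] at hlt
    linarith
  · rw [Finset.not_nonempty_iff_eq_empty.1 hne, Finset.card_empty, Nat.cast_zero]
    positivity

omit [Fintype Ω] [Nonempty Ω] in
/-- Restricting a `[0,1]`-valued double average to a large subset changes it by at most the excluded mass. [folklore] -/
theorem abs_avg_sub_avg_restrict_le {κ : Type*} (K : Finset κ) (hK : K.Nonempty) (W W' : Finset (Fin t → Ω)) (hsub : W' ⊆ W) (hW : W.Nonempty) (hW' : W'.Nonempty)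
    (G : κ → (Fin t → Ω) → ℝ) (hG0 : ∀ k w, 0 ≤ G k w) (hG1 : ∀ k w, G k w ≤ 1) :
    |(∑ k ∈ K, ∑ w ∈ W, G k w) / (K.card * W.card) - (∑ k ∈ K, ∑ w ∈ W', G k w) / (K.card * W'.card)| ≤ ((W \ W').card : ℝ) / W.card := by
  have hKc : (0 : ℝ) < K.card := by exact_mod_cast hK.card_pos
  have hWc : (0 : ℝ) < W.card := by exact_mod_cast hW.card_pos
  have hW'c : (0 : ℝ) < W'.card := by exact_mod_cast hW'.card_pos
  -- split the full sum
  have hsplit : ∀ k, ∑ w ∈ W, G k w = ∑ w ∈ W', G k w + ∑ w ∈ W \ W', G k w := fun k => by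
    rw [← Finset.sum_union (Finset.disjoint_sdiff), Finset.union_sdiff_of_subset hsub]
  have hcardW : (W.card : ℝ) = W'.card + (W \ W').card := by
    have := Finset.card_sdiff_add_card_eq_card hsub; push_cast [← this]; ring
  set A := ∑ k ∈ K, ∑ w ∈ W', G k w with hA
  set B := ∑ k ∈ K, ∑ w ∈ W \ W', G k w with hB
  have hfull : ∑ k ∈ K, ∑ w ∈ W, G k w = A + B := by
    rw [hA, hB, ← Finset.sum_add_distrib]; exact Finset.sum_congr rfl fun k _ => hsplit k
  have hA0 : 0 ≤ A := Finset.sum_nonneg fun k _ => Finset.sum_nonneg fun w _ => hG0 k w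
  have hA1 : A ≤ K.card * W'.card := by
    calc A ≤ ∑ k ∈ K, ∑ w ∈ W', (1 : ℝ) := Finset.sum_le_sum fun k _ => Finset.sum_le_sum fun w _ => hG1 k w
      _ = K.card * W'.card := by simp
  have hB0 : 0 ≤ B := Finset.sum_nonneg fun k _ => Finset.sum_nonneg fun w _ => hG0 k w
  have hB1 : B ≤ K.card * (W \ W').card := by
    calc B ≤ ∑ k ∈ K, ∑ w ∈ W \ W', (1 : ℝ) := Finset.sum_le_sum fun k _ => Finset.sum_le_sum fun w _ => hG1 k w
      _ = K.card * (W \ W').card := by simp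
  rw [hfull]
  set d : ℝ := ((W \ W').card : ℝ) with hd
  have hd0 : 0 ≤ d := Nat.cast_nonneg _
  -- `(A + B)/(K W) − A/(K W') = (B·W' − A·d)/(K W W')`
  have hkey : (A + B) / (K.card * W.card) - A / (K.card * W'.card) = (B * W'.card - A * d) / (K.card * W.card * W'.card) := by
    rw [hcardW]; field_simp; ring
  rw [hkey, abs_div, abs_of_pos (by positivity : (0 : ℝ) < K.card * W.card * W'.card), div_le_div_iff₀ (by positivity) hWc]
  have habs : |B * W'.card - A * d| ≤ K.card * d * W'.card := by
    rw [abs_le]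
    constructor
    · have : A * d ≤ K.card * W'.card * d := mul_le_mul_of_nonneg_right hA1 hd0
      nlinarith [mul_nonneg hB0 hW'c.le]
    · have : B * W'.card ≤ K.card * d * W'.card := mul_le_mul_of_nonneg_right hB1 hW'c.le
      nlinarith [mul_nonneg hA0 hd0]
  calc |B * W'.card - A * d| * W.card ≤ K.card * d * W'.card * W.card := mul_le_mul_of_nonneg_right habs hWc.le
    _ = d * (K.card * W.card * W'.card) := by ring

/-- **Extraction of flattened conditional entropy, smooth test form**: with `ε|W| ≥ #heavy` (`ε ≤ ½`), every
`[0,1]`-test of (side tuple, key, hash value) is fooled up to `2·#heavy/|W| + ½ √(2^m · 2^{1−kmin})`,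
`kmin = t(H(x,y) − H(y)) − tη log₂|Ω|`; and `#heavy ≤ e^{−2tη²}|W|` (`card_condHeavy_tuple_le_exp`).
[cite: HastadImpagliazzoLevinLuby1999, Cor. 4.5.3 (with Prop. 4.4.1 and Lemma 4.5.1)] -/
theorem extract_cond_test_smooth (x : Ω → List.Vector Bool c) (y : Ω → V) (ht : 0 < t) {η : ℝ} (hη : 0 ≤ η) (hΩ : 1 < Fintype.card Ω)
    {m keyLen : ℕ} (hkey : m * (t * c + 1) ≤ keyLen) (hε : 2 * Real.exp (-2 * t * η ^ 2) ≤ 1)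
    (F : (Fin t → V) → List.Vector Bool keyLen × (Fin m → ZMod 2) → ℝ) (hF0 : ∀ cv p, 0 ≤ F cv p) (hF1 : ∀ cv p, F cv p ≤ 1) :
    |(∑ U : List.Vector Bool keyLen, ∑ w : Fin t → Ω, F (ztup y w) (U, hashV (t * c) m U.toList (xvec x w))) /
          ((Finset.univ : Finset (List.Vector Bool keyLen)).card * (Finset.univ : Finset (Fin t → Ω)).card) -
        (∑ U : List.Vector Bool keyLen, ∑ w : Fin t → Ω, ∑ u : Fin m → ZMod 2, F (ztup y w) (U, u)) /
          ((Finset.univ : Finset (List.Vector Bool keyLen)).card * (Finset.univ : Finset (Fin t → Ω)).card * Fintype.card (Fin m → ZMod 2))| ≤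
      2 * Real.exp (-2 * t * η ^ 2) + 2⁻¹ * Real.sqrt (2 ^ m * (2 * (2 : ℝ) ^
        (-(t * (mapEntropy Finset.univ (fun v => (x v, y v)) - mapEntropy Finset.univ y) - t * η * Real.logb 2 (Fintype.card Ω))))) := by
  classical
  set kmin : ℝ := t * (mapEntropy Finset.univ (fun v => (x v, y v)) - mapEntropy Finset.univ y) - t * η * Real.logb 2 (Fintype.card Ω) with hkmin
  set ε : ℝ := Real.exp (-2 * t * η ^ 2) with hεdef
  set W : Finset (Fin t → Ω) := Finset.univ with hWdef
  set W' : Finset (Fin t → Ω) := lightSet (t := t) x y kmin with hW'def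
  set Kk : Finset (List.Vector Bool keyLen) := Finset.univ with hKdef
  have hWcard : (W.card : ℝ) = (Fintype.card Ω : ℝ) ^ t := by rw [hWdef, Finset.card_univ, Fintype.card_fun, Fintype.card_fin]; push_cast; ring
  have hWpos : (0 : ℝ) < W.card := by rw [hWcard]; exact pow_pos (by exact_mod_cast Fintype.card_pos) t
  have hheavy : ((heavySet (t := t) x y kmin).card : ℝ) ≤ ε * W.card := by
    rw [hWcard]; exact card_condHeavy_tuple_le_exp x y ht hη hΩ
  have hsdiff : W \ W' = heavySet (t := t) x y kmin := by
    ext w; simp [hWdef, hW'def, lightSet, heavySet]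
  have hW'card : (W'.card : ℝ) = W.card - (heavySet (t := t) x y kmin).card := by
    have := card_heavy_add_light (t := t) x y kmin
    rw [hWdef, Finset.card_univ]
    have h' : ((heavySet (t := t) x y kmin).card : ℝ) + (lightSet (t := t) x y kmin).card = Fintype.card (Fin t → Ω) := by exact_mod_cast this
    rw [hW'def]; linarith
  have hW'ge : W.card / 2 ≤ (W'.card : ℝ) := by
    rw [hW'card]
    have : ε * W.card ≤ W.card / 2 := by
      have hε' : ε ≤ 1 / 2 := by rw [hεdef]; linarith
      nlinarith
    linarith
  have hW'pos : (0 : ℝ) < W'.card := by linarith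
  have hW'ne : W'.Nonempty := by rw [← Finset.card_pos]; exact_mod_cast hW'pos
  -- LHL on the light set
  have hK : LeftoverHash.IsPairwiseIndep Kk (fun U a => hashV (t * c) m U.toList a) (Finset.univ : Finset (List.Vector Bool (t * c))) :=
    isPairwiseIndep_hashV hkey _
  set M : (Fin t → V) → ℕ := fun cv => Nat.floor ((2 : ℝ) ^ (-kmin) * ((Finset.univ.filter fun w : Fin t → Ω => ztup y w = cv).card : ℝ)) with hMdef
  have hM : ∀ cv a, (W'.filter fun w => ztup y w = cv ∧ xvec x w = a).card ≤ M cv := fun cv a =>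
    Nat.le_floor (card_light_fibre_le x y kmin cv a)
  have hL := LeftoverHash.leftoverHash_cond_test (Finset.univ_nonempty (α := List.Vector Bool keyLen)) hK hW'ne (z := ztup y) (x := xvec x)
    (fun w _ => Finset.mem_univ _) M hM F hF0 hF1
  -- `Σ_c M_c ≤ 2^{-kmin} |W|`
  have hsumM : (∑ cv ∈ W'.image (ztup y), (M cv : ℝ)) ≤ (2 : ℝ) ^ (-kmin) * W.card := by
    calc (∑ cv ∈ W'.image (ztup y), (M cv : ℝ)) ≤ ∑ cv ∈ W.image (ztup y), (M cv : ℝ) :=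
          Finset.sum_le_sum_of_subset_of_nonneg (Finset.image_subset_image (Finset.subset_univ _)) fun _ _ _ => Nat.cast_nonneg _
      _ ≤ ∑ cv ∈ W.image (ztup y), (2 : ℝ) ^ (-kmin) * ((Finset.univ.filter fun w : Fin t → Ω => ztup y w = cv).card : ℝ) :=
          Finset.sum_le_sum fun cv _ => Nat.floor_le (by positivity)
      _ = (2 : ℝ) ^ (-kmin) * W.card := by
          rw [← Finset.mul_sum, ← Nat.cast_sum, hWdef, LeftoverHash.sum_card_filter_val]
  have hγ : (Fintype.card (Fin m → ZMod 2) : ℝ) = 2 ^ m := by rw [Fintype.card_fun, Fintype.card_fin, ZMod.card]; push_cast; ring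
  have hLHL : |(∑ U ∈ Kk, ∑ w ∈ W', F (ztup y w) (U, hashV (t * c) m U.toList (xvec x w))) / (Kk.card * W'.card) -
      (∑ U ∈ Kk, ∑ w ∈ W', ∑ u : Fin m → ZMod 2, F (ztup y w) (U, u)) / (Kk.card * W'.card * Fintype.card (Fin m → ZMod 2))| ≤
      2⁻¹ * Real.sqrt (2 ^ m * (2 * (2 : ℝ) ^ (-kmin))) := by
    refine hL.trans (mul_le_mul_of_nonneg_left (Real.sqrt_le_sqrt ?_) (by norm_num))
    rw [hγ, mul_div_assoc]
    refine mul_le_mul_of_nonneg_left ?_ (by positivity)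
    rw [div_le_iff₀ hW'pos]
    calc (∑ cv ∈ W'.image (ztup y), (M cv : ℝ)) ≤ (2 : ℝ) ^ (-kmin) * W.card := hsumM
      _ ≤ 2 * (2 : ℝ) ^ (-kmin) * W'.card := by
          have h2 : (0 : ℝ) ≤ (2 : ℝ) ^ (-kmin) := by positivity
          nlinarith
      _ = 2 * (2 : ℝ) ^ (-kmin) * W'.card := rfl
  -- the two restrictions
  have hKne : Kk.Nonempty := Finset.univ_nonempty
  have hR1 := abs_avg_sub_avg_restrict_le Kk hKne W W' (Finset.subset_univ _) Finset.univ_nonempty hW'ne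
    (fun U w => F (ztup y w) (U, hashV (t * c) m U.toList (xvec x w))) (fun _ _ => hF0 _ _) (fun _ _ => hF1 _ _)
  have hG0 : ∀ (U : List.Vector Bool keyLen) (w : Fin t → Ω), 0 ≤ (∑ u : Fin m → ZMod 2, F (ztup y w) (U, u)) / Fintype.card (Fin m → ZMod 2) :=
    fun U w => div_nonneg (Finset.sum_nonneg fun _ _ => hF0 _ _) (Nat.cast_nonneg _)
  have hG1 : ∀ (U : List.Vector Bool keyLen) (w : Fin t → Ω), (∑ u : Fin m → ZMod 2, F (ztup y w) (U, u)) / Fintype.card (Fin m → ZMod 2) ≤ 1 := by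
    intro U w
    rw [div_le_one (by rw [hγ]; positivity)]
    calc (∑ u : Fin m → ZMod 2, F (ztup y w) (U, u)) ≤ ∑ u : Fin m → ZMod 2, (1 : ℝ) := Finset.sum_le_sum fun _ _ => hF1 _ _
      _ = Fintype.card (Fin m → ZMod 2) := by simp
  have hR2 := abs_avg_sub_avg_restrict_le Kk hKne W W' (Finset.subset_univ _) Finset.univ_nonempty hW'ne
    (fun U w => (∑ u : Fin m → ZMod 2, F (ztup y w) (U, u)) / Fintype.card (Fin m → ZMod 2)) hG0 hG1
  -- rewrite the triple-sum averages as double averages of `G`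
  have hγpos : (0 : ℝ) < Fintype.card (Fin m → ZMod 2) := by rw [hγ]; positivity
  have htri : ∀ (Wx : Finset (Fin t → Ω)), (∑ U ∈ Kk, ∑ w ∈ Wx, ∑ u : Fin m → ZMod 2, F (ztup y w) (U, u)) / (Kk.card * Wx.card * Fintype.card (Fin m → ZMod 2)) =
      (∑ U ∈ Kk, ∑ w ∈ Wx, (∑ u : Fin m → ZMod 2, F (ztup y w) (U, u)) / Fintype.card (Fin m → ZMod 2)) / (Kk.card * Wx.card) := by
    intro Wx
    have e : ∑ U ∈ Kk, ∑ w ∈ Wx, (∑ u : Fin m → ZMod 2, F (ztup y w) (U, u)) / Fintype.card (Fin m → ZMod 2) =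
        (∑ U ∈ Kk, ∑ w ∈ Wx, ∑ u : Fin m → ZMod 2, F (ztup y w) (U, u)) / Fintype.card (Fin m → ZMod 2) := by
      rw [Finset.sum_div]
      exact Finset.sum_congr rfl fun U _ => by rw [Finset.sum_div]
    rw [e, div_div, mul_comm (Fintype.card (Fin m → ZMod 2) : ℝ)]
  rw [htri W] 
  rw [htri W'] at hLHL
  have hexcl : ((W \ W').card : ℝ) / W.card ≤ ε := by
    rw [hsdiff, div_le_iff₀ hWpos]; exact hheavy
  -- triangle inequality
  have key : ∀ (a a' b b' : ℝ), |a - a'| ≤ ε → |b - b'| ≤ ε → |a' - b'| ≤ 2⁻¹ * Real.sqrt (2 ^ m * (2 * (2 : ℝ) ^ (-kmin))) →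
      |a - b| ≤ 2 * ε + 2⁻¹ * Real.sqrt (2 ^ m * (2 * (2 : ℝ) ^ (-kmin))) := by
    intro a a' b b' h1 h2 h3
    calc |a - b| = |(a - a') + (a' - b') - (b - b')| := by ring_nf
      _ ≤ |(a - a') + (a' - b')| + |b - b'| := abs_sub _ _
      _ ≤ |a - a'| + |a' - b'| + |b - b'| := by linarith [abs_add_le (a - a') (a' - b')]
      _ ≤ _ := by linarith
  exact key _ _ _ _ (hR1.trans hexcl) (hR2.trans hexcl) hLHL

end Extract

end HILL

end Literature.Computability.Cryptography
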